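import Literature.Computability.AlgebraicComplexity.ZariskiClosureBaseChange
import HarnessLib

/-!
# Border determinantal complexity of the permanent is ONE number across characteristic `0`

Topic `Literature/Computability/AlgebraicComplexity`. THEOREMS ONLY (no definition, no named fact;
census-neutral). A consequence of base change (val-lit x3 g5's `ZariskiClosureBaseChange.lean`,
programme #10): the tree's border notions for the padded permanent are FIELD-INDEPENDENT over
characteristic `0`.

* `map_paddedPerPoly`: the padded permanent `X₀₀^{m−n} · per_n` (`paddedPerPoly`, Mulmuley–Sohoni
  2001 §4) has integer coefficients: it is the base change of its `ℚ`-version along any ring map.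
* `hasBorderDetRepr_iff_rat`: for every field `F` of characteristic `0`,
  `HasBorderDetRepr F n m ↔ HasBorderDetRepr ℚ n m` — `X₀₀^{m−n} per_n ∈ \overline{GL_{m²}(F) · det_m}`
  (Zariski closure over `F`) iff the same holds over `ℚ`. Descent along `ℚ ⊆ F`
  (`mem_orbitClosure_of_map_mem`: a polynomial in the coefficients vanishing on `GL_{m²}(ℚ) · det_m`
  vanishes on `GL_{m²}(F) · det_m`, `ℚ` being infinite) and ascent (`map_mem_orbitClosure_map`:
  the vanishing ideal of the dense set of `ℚ`-points is defined over `ℚ`).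
* `hasBorderDetRepr_iff_complex`, `hasBorderDetRepr_iff_of_charZero`: hence any two fields of
  characteristic `0` agree, in particular every such `F` agrees with `ℂ`;
* `borderDetComplexityPer_eq_of_charZero` / `borderDetComplexityPer_eq_complex`:
  `\underline{dc}_F(per_n) = \underline{dc}_ℂ(per_n)` (`borderDetComplexityPer`, an `sInf` over the
  same set of `m`).

No printed locator is claimed for these statements (folklore consequence of the Lefschetz
principle / base change for Zariski closures of orbits of `ℚ`-rational points; cf. Milne,
*Algebraic Groups* §1.e, and Mulmuley–Sohoni 2001 §4 for the objects); `lit`-seat may attach one.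
NOT a Summit consumer: the summit `ValiantsHypothesis` is fixed at `F = ℂ`. Honest framing:
bookkeeping; nothing here bears on VP versus VNP, which is NOT proved.

Provenance: cell `val-lit`, literature-prover val-lit-t02 g9 (lead-bip QUICK 2026-08-27 13:20Z (1)(b)).
-/

noncomputable section

open MvPolynomial

namespace Literature.Computability.AlgebraicComplexity

variable {k k' : Type*} [Field k] [Field k']

/-- **The padded permanent has integer coefficients**: `map f (X₀₀^{m−n} · per_n) = X₀₀^{m−n} · per_n`
for every ring map `f : k → k'` of fields (Mulmuley–Sohoni 2001 §4: `ℓ^{m−n} perm(X')`, `ℓ` a new variable).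
[cite: MulmuleySohoni2001, §4] -/
theorem map_paddedPerPoly (f : k →+* k') (n m : ℕ) [NeZero m] :
    map f (paddedPerPoly k n m) = paddedPerPoly k' n m := by
  simp only [paddedPerPoly, map_mul, map_pow, map_X, map_rename, map_perPoly]

variable (F : Type*) [Field F] [CharZero F]

/-- **Field independence of border determinantal representability over characteristic `0`**:
`X₀₀^{m−n} · per_n ∈ \overline{GL_{m²}(F) · det_m}` (Zariski closure over `F`) iff the same holds
over `ℚ`. Descent: `mem_orbitClosure_of_map_mem` (`ℚ` infinite); ascent: `map_mem_orbitClosure_map`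
(val-lit x3 g5, `ZariskiClosureBaseChange`). A consequence of base change; no printed locator
claimed. [cite: MulmuleySohoni2001, §4 (the objects `Δ[det_m]`, `ℓ^{m−n} perm`)] -/
theorem hasBorderDetRepr_iff_rat (n m : ℕ) [NeZero m] :
    HasBorderDetRepr F n m ↔ HasBorderDetRepr ℚ n m := by
  constructor
  · intro h
    refine mem_orbitClosure_of_map_mem (K := F) ?_
    rw [map_paddedPerPoly, map_detPoly]
    exact h
  · intro h
    have h' := map_mem_orbitClosure_map (K := F) h
    rw [map_paddedPerPoly, map_detPoly] at h'
    exact h'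

/-- Any two fields of characteristic `0` agree on `HasBorderDetRepr` (both agree with `ℚ`).
A consequence of base change; no printed locator claimed. [cite: MulmuleySohoni2001, §4] -/
theorem hasBorderDetRepr_iff_of_charZero (F' : Type*) [Field F'] [CharZero F'] (n m : ℕ) [NeZero m] :
    HasBorderDetRepr F n m ↔ HasBorderDetRepr F' n m := by
  rw [hasBorderDetRepr_iff_rat F, hasBorderDetRepr_iff_rat F']

/-- In particular every field of characteristic `0` agrees with `ℂ` on border determinantal
representability of the padded permanent. [cite: MulmuleySohoni2001, §4] -/
theorem hasBorderDetRepr_iff_complex (n m : ℕ) [NeZero m] :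
    HasBorderDetRepr F n m ↔ HasBorderDetRepr ℂ n m :=
  hasBorderDetRepr_iff_of_charZero F ℂ n m

/-- **`\underline{dc}(per_n)` is the same over every field of characteristic `0`**: the tree's
`borderDetComplexityPer F n` (least `m ≥ max n 1` with `X₀₀^{m−n} per_n ∈ \overline{GL_{m²}·det_m}`)
does not depend on the characteristic-`0` field `F`. [cite: MulmuleySohoni2001, §4] -/
theorem borderDetComplexityPer_eq_of_charZero (F' : Type*) [Field F'] [CharZero F'] (n : ℕ) :
    borderDetComplexityPer F n = borderDetComplexityPer F' n := by
  unfold borderDetComplexityPer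
  congr 1
  ext m
  simp only [Set.mem_setOf_eq]
  constructor
  · rintro ⟨hm, hnm, h⟩
    exact ⟨hm, hnm, (@hasBorderDetRepr_iff_of_charZero F _ _ F' _ _ n m (NeZero.of_pos hm)).mp h⟩
  · rintro ⟨hm, hnm, h⟩
    exact ⟨hm, hnm, (@hasBorderDetRepr_iff_of_charZero F _ _ F' _ _ n m (NeZero.of_pos hm)).mpr h⟩

/-- `\underline{dc}_F(per_n) = \underline{dc}_ℂ(per_n)` for every field `F` of characteristic `0`.
[cite: MulmuleySohoni2001, §4] -/
theorem borderDetComplexityPer_eq_complex (n : ℕ) :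
    borderDetComplexityPer F n = borderDetComplexityPer ℂ n :=
  borderDetComplexityPer_eq_of_charZero F ℂ n

end Literature.Computability.AlgebraicComplexity

end
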